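import Summits.ResolutionOfSingularities.ResolutionOfSingularities.Theorems.ProximityCutClasses
import HarnessLib

/-!
# TightCutClasses — decomp-res node «TightCut» (lens-3 g17), tree file 6/7 (route-independent, OUTSIDE the
Theses cone; importable by the route
file for the aside): the §K3 classes of the shade axis one window further — `NoShadeThreeJointTailsDeep` (THE
SHADE-THREE WINDOW of the joint
residual, `q = p^e ≥ 7`; DECIDED — PROVED EMPTY in `MaxContactCutTightCut.noShadeThreeJointTails_holds`) and
`NoJointTailsFromFourDeep` (THE LOCATED
RESIDUAL of the node: joint tails of shade `≥ 4`, or of the tiny modulus `q = 4`; binders of the tree's joint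
residual VERBATIM).  Statements only.

Content VERBATIM from the decomp-res lens-3 g17 file `HOME/decomp-res-lens-3/g17/TightCut.lean` (sha256
7fe2fb69bd2eaf82, 3149 l;
HOME = run/shared/lean/pub/decomp-res).  Critic: CRITIC-LEDGER row 136 CLEARED, landing order 2026-08-30T19:49:35Z
(after node «ShadeCut» =
`Theorems/ShadeCutLawJ`, `ShadeCutTailTwo`, `ShadeCutShadeTwo`, `MaxContactCutShadeCut`).

[WRITER NOTE (decomp-res writer g7): the lens's carried VERBATIM copies §V1/§V2 (g15 ConeCut calculus),
§J/§S/§K/§L/§M (g16 ShadeCut) are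
DELETED in favour of the landed `Theorems/ConeCut*`, `ConeCutAxisLaw`, `FloorCutFloor`, `ShadeCut*`,
`MaxContactCutShadeCut` (imported and
opened; `exists_third`/`exists_ne` now the tree's `ConeCut.exists_third` / `FloorCut.exists_ne`); the by-name
`closes` re-export (§M) is not
restated.  NEW content only, split by the lens's own sections (400-line file limit): `TightCutLawJ2`
(§J₂.1–§J₂.3), `TightCutWitness`
(§J₂.4–§J₂.5), `TightCutCharts` + `TightCutCharts2` (§J₂.6), `TightCutPoverty` (§P), `TightCutClasses`
(cone-free: the two §K3 classes, home of
the aside), `MaxContactCutTightCut` (Theses cone: §K3 theorems + §L4 + §N).  ONE namespace `…Theorems.TightCut`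
as in the lens; global
`set_option` line dropped; nothing else changed.]
(Sources: CossartPiltant2008 Prop. 4.2; CossartPiltant2009; CossartJannsenSaito2020; Hauser2010; Moh1987;
HauserPerlega2019; BenitoVillamayor2012; Cutkosky2009 Thm. 5.1.)
-/

noncomputable section

open MvPolynomial Finset
open Literature.AlgebraicGeometry.Resolution
open Literature.AlgebraicGeometry.Resolution.Hauser2010
open Literature.AlgebraicGeometry.Resolution.PointBlowup
open Literature.AlgebraicGeometry.Resolution.WeightedBlowup
open Summit.ResolutionOfSingularities.ResolutionOfSingularities.Theorems.TightDefectClasses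
open Summit.ResolutionOfSingularities.ResolutionOfSingularities.Theorems.TightDefectStrongWalks
open Summit.ResolutionOfSingularities.ResolutionOfSingularities.Theorems.ItineraryCutClasses
open Summit.ResolutionOfSingularities.ResolutionOfSingularities.Theorems.ProximityCut

namespace Summit.ResolutionOfSingularities.ResolutionOfSingularities.Theorems.TightCut

/-! ### §K3 (g17) — the shade axis one window further: WINDOW `s = 3` (`q ≥ 7`) DECIDED, residual RE-LOCATED at
`s ≥ 4` (plus the single tiny modulus `q = 4`), EXACT. -/

/-- PIECE · THE SHADE-THREE WINDOW of the joint residual (binders VERBATIM, plus the window clauses `shade_N = 3`,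
`7 ≤ p^e`) · WEAKER than `NoJointTailsFromThreeDeep` by letter (`shadeThree_of_three`) · **DECIDED — PROVED EMPTY**
(`noShadeThreeJointTails_holds`, by LAW J + LAW J₂ + the poverty ledger): no infinite deep defect walk with
`q = p^e ≥ 7` sits for ever on a plateau of shade `3` with positive excess, proximity repeats infinitely often and
translated moves infinitely often. -/
def NoShadeThreeJointTailsDeep : Prop :=
  ∀ p : ℕ, p.Prime → ∀ e : ℕ, 2 ≤ e → ∀ (K : Type) [Field K] [CharP K p] [PerfectField K] [DecidableEq K]
    (s₀ : State (Fin 3) K), IsRoot (p ^ e) s₀ → ∀ W : ForcedWalk (p ^ e) s₀, (∀ i, 1 ≤ (W.st i).shade) →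
    ∀ N : ℕ, (∀ t, N ≤ t → (W.st (t + 1)).shade = (W.st t).shade) →
    (∀ t, N ≤ t → ordZero (W.st t).F ≠ ((p ^ e : ℕ) : ℕ∞)) → (∀ M : ℕ, ∃ t, M ≤ t ∧ StaysOnNewest W t) →
    (∀ M : ℕ, ∃ t, M ≤ t ∧ W.b t ≠ 0) → (W.st N).shade = ((3 : ℕ) : ℕ∞) → 7 ≤ p ^ e → False

/-- PIECE · THE LOCATED RESIDUAL OF THIS NODE — JOINT TAILS OF SHADE AT LEAST FOUR, OR OF THE TINY MODULUS
`q = p^e < 7` (i.e. `q = 4`) (binders of the tree's joint residual VERBATIM, plus `4 ≤ shade_N ∨ p^e < 7`) · WEAKER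
than `NoJointTailsFromThreeDeep` by letter (`four_of_three`) · EXACT (`three_iff_four`) · UNDECIDED · IDEA-NEEDED
(SEED-g18: the depth laws `J_n` at corner `q − 3`, and the poverty ledger at shade `n` for `q ≥ 3n − 2`). -/
def NoJointTailsFromFourDeep : Prop :=
  ∀ p : ℕ, p.Prime → ∀ e : ℕ, 2 ≤ e → ∀ (K : Type) [Field K] [CharP K p] [PerfectField K] [DecidableEq K]
    (s₀ : State (Fin 3) K), IsRoot (p ^ e) s₀ → ∀ W : ForcedWalk (p ^ e) s₀, (∀ i, 1 ≤ (W.st i).shade) →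
    ∀ N : ℕ, (∀ t, N ≤ t → (W.st (t + 1)).shade = (W.st t).shade) →
    (∀ t, N ≤ t → ordZero (W.st t).F ≠ ((p ^ e : ℕ) : ℕ∞)) → (∀ M : ℕ, ∃ t, M ≤ t ∧ StaysOnNewest W t) →
    (∀ M : ℕ, ∃ t, M ≤ t ∧ W.b t ≠ 0) → (((4 : ℕ) : ℕ∞) ≤ (W.st N).shade ∨ p ^ e < 7) → False

end Summit.ResolutionOfSingularities.ResolutionOfSingularities.Theorems.TightCut
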